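import Literature.AnabelianGeometry.SemiGraphs.UniversalCoveringOverFibres

/-!
# The covering `𝒢_{∞,S} → 𝒢` ([SemiAnbd] §3 p. 38) — gluing and the object of `B^cov(𝒢)`

Sequel to `UniversalCoveringOverFibres.lean`.  For `S` an object of `B^cov(𝒢)` (`𝒢` countable)
and a base component `c` of its underlying semi-graph `𝔾_S`, the fibres `(V, x, p)` / `(E, y, q)`
of `𝒢_{∞,S}` are glued along a branch `b : e → v` by
`(E, y, q) ↦ (glue_b E, glue_b y, q ≫ b̃)`, where `b̃ : E → glue_b E` is the arrow of `Cat(𝔾_S)`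
given by the branch of `E` over `b`.  Result: the object `S.univCoverOver c h𝒢 : CovObj 𝒢`
("the covering of `𝒢_i` determined by the universal graph-covering of `𝔾_i`", composed with
`𝒢_i → 𝒢`) together with its projection to `S`.
-/

namespace Literature.AnabelianGeometry.SemiGraphs

namespace ProfiniteSemiGraph

open CategoryTheory

universe u

variable {𝒢 : ProfiniteSemiGraph.{u}} (S : CovObj 𝒢) (c : S.orbitGraph.CatCarrier)

/-- The branch of `𝔾_S` over `b` of an edge-orbit over `edgeOf b` abuts to the orbit of the glued
point. [cite: MochizukiSemiAnbd2006, Prop 3.6 p.38] -/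
theorem CovObj.orbitGraph_abuts_mk (b : 𝒢.graph.Branch) (v : 𝒢.graph.Vertex)
    (h : 𝒢.graph.abuts b = some v) (E : {E : S.OEdge // CovObj.OEdge.base S E = 𝒢.graph.edgeOf b})
    (y : (S.SE (𝒢.graph.edgeOf b)).obj.V) (hy : Quot.mk _ ⟨𝒢.graph.edgeOf b, y⟩ = E.1) :
    S.orbitGraph.abuts ⟨(b, E.1), E.2⟩ =
      some (Quot.mk _ ⟨v, (S.glue b v h).hom.hom.hom y⟩) := by
  rw [S.orbitGraph_abuts_of_abuts b E.1 E.2 v h, ← hy]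
  exact S.glueOpt_mk b v h y

/-- The arrow `b̃ : E → glue_b(E)` of `Cat(𝔾_S)` attached to the branch over `b` of the edge-orbit
`E` (through a representative `y` of `E`). [cite: MochizukiSemiAnbd2006, Prop 3.6 p.38] -/
noncomputable def CovObj.brArrowOver (b : 𝒢.graph.Branch) (v : 𝒢.graph.Vertex)
    (h : 𝒢.graph.abuts b = some v) (E : {E : S.OEdge // CovObj.OEdge.base S E = 𝒢.graph.edgeOf b})
    (y : (S.SE (𝒢.graph.edgeOf b)).obj.V) (hy : Quot.mk _ ⟨𝒢.graph.edgeOf b, y⟩ = E.1) :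
    S.orbitGraph.basept (Sum.inr E.1) ⟶
      S.orbitGraph.basept (Sum.inl (Quot.mk _ ⟨v, (S.glue b v h).hom.hom.hom y⟩)) :=
  S.orbitGraph.brArrow ⟨(b, E.1), E.2⟩ E.1 _ rfl (S.orbitGraph_abuts_mk b v h E y hy)

/-- The gluing map of `𝒢_{∞,S}` along `b : e → v` on underlying sets:
`(E, y, q) ↦ (glue_b E, glue_b y, q ≫ b̃)`. [cite: MochizukiSemiAnbd2006, Prop 3.6 p.38] -/
noncomputable def CovObj.glueOverFun (b : 𝒢.graph.Branch) (v : 𝒢.graph.Vertex)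
    (h : 𝒢.graph.abuts b = some v) : S.FibE c (𝒢.graph.edgeOf b) → S.FibV c v :=
  fun t => ⟨⟨Quot.mk _ ⟨v, (S.glue b v h).hom.hom.hom t.2.1.1⟩, rfl⟩,
    ⟨⟨(S.glue b v h).hom.hom.hom t.2.1.1, rfl⟩, t.2.2 ≫ S.brArrowOver b v h t.1 t.2.1.1 t.2.1.2⟩⟩

/-- `glue⁻¹ (glue y) = y`. [cite: MochizukiSemiAnbd2006, Def 3.5(i) p.37] -/
theorem CovObj.glue_inv_hom (b : 𝒢.graph.Branch) (v : 𝒢.graph.Vertex)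
    (h : 𝒢.graph.abuts b = some v) (y : (S.SE (𝒢.graph.edgeOf b)).obj.V) :
    (S.glue b v h).inv.hom.hom ((S.glue b v h).hom.hom.hom y) = y :=
  ConcreteCategory.congr_hom (congrArg
    (fun φ : S.SE (𝒢.graph.edgeOf b) ⟶ S.SE (𝒢.graph.edgeOf b) => φ.hom.hom)
    (S.glue b v h).hom_inv_id) y

/-- `glue (glue⁻¹ x) = x`. [cite: MochizukiSemiAnbd2006, Def 3.5(i) p.37] -/
theorem CovObj.glue_hom_inv (b : 𝒢.graph.Branch) (v : 𝒢.graph.Vertex)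
    (h : 𝒢.graph.abuts b = some v) (x : (S.SV v).obj.V) :
    (S.glue b v h).hom.hom.hom ((S.glue b v h).inv.hom.hom x) = x :=
  ConcreteCategory.congr_hom (congrArg
    (fun φ : (BTemp.res (𝒢.brHom b v h)).obj (S.SV v) ⟶ (BTemp.res (𝒢.brHom b v h)).obj (S.SV v) =>
      φ.hom.hom) (S.glue b v h).inv_hom_id) x

/-- The inverse gluing map: `(V, x, p) ↦ (E, glue⁻¹ x, p ≫ b̃⁻¹)` with `E` the orbit of `glue⁻¹ x`.
[cite: MochizukiSemiAnbd2006, Prop 3.6 p.38] -/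
noncomputable def CovObj.glueOverInv (b : 𝒢.graph.Branch) (v : 𝒢.graph.Vertex)
    (h : 𝒢.graph.abuts b = some v) : S.FibV c v → S.FibE c (𝒢.graph.edgeOf b) :=
  fun s =>
    let y := (S.glue b v h).inv.hom.hom s.2.1.1
    let E : {E : S.OEdge // CovObj.OEdge.base S E = 𝒢.graph.edgeOf b} :=
      ⟨Quot.mk _ ⟨𝒢.graph.edgeOf b, y⟩, rfl⟩
    have hV : S.orbitGraph.basept (Sum.inl s.1.1) =
        S.orbitGraph.basept (Sum.inl (Quot.mk _ ⟨v, (S.glue b v h).hom.hom.hom y⟩)) := by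
      rw [S.glue_hom_inv b v h, s.2.1.2]
    ⟨E, ⟨⟨y, rfl⟩, s.2.2 ≫ eqToHom hV ≫ inv (S.brArrowOver b v h E y rfl)⟩⟩

/-- `glueOverInv ∘ glueOverFun = id`. [cite: MochizukiSemiAnbd2006, Prop 3.6 p.38] -/
theorem CovObj.glueOverInv_glueOverFun (b : 𝒢.graph.Branch) (v : 𝒢.graph.Vertex)
    (h : 𝒢.graph.abuts b = some v) (t : S.FibE c (𝒢.graph.edgeOf b)) :
    S.glueOverInv c b v h (S.glueOverFun c b v h t) = t := by
  cases t with | mk E' yq =>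
  cases yq with | mk yy q =>
  cases yy with | mk y hy =>
  cases E' with | mk E hE =>
  change Quot.mk _ _ = E at hy
  subst hy
  have hgy : (S.glue b v h).inv.hom.hom ((S.glue b v h).hom.hom.hom y) = y := S.glue_inv_hom b v h y
  refine CovObj.FibE.ext S c (Subtype.ext ?_) ?_ ?_
  · change Quot.mk _ (⟨𝒢.graph.edgeOf b, (S.glue b v h).inv.hom.hom ((S.glue b v h).hom.hom.hom y)⟩ :
      Σ e, (S.SE e).obj.V) = Quot.mk _ ⟨𝒢.graph.edgeOf b, y⟩
    rw [hgy]
  · exact hgy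
  · -- the path: `(q ≫ b̃) ≫ eqToHom ≫ b̃'⁻¹ ≍ q`; generalise the point `z = glue⁻¹ (glue y)`
    have aux : ∀ (z : (S.SE (𝒢.graph.edgeOf b)).obj.V) (hz : z = y)
        (hE' : CovObj.OEdge.base S (Quot.mk _ ⟨𝒢.graph.edgeOf b, z⟩) = 𝒢.graph.edgeOf b)
        (H : S.orbitGraph.basept (Sum.inl (Quot.mk _ ⟨v, (S.glue b v h).hom.hom.hom y⟩)) =
          S.orbitGraph.basept (Sum.inl (Quot.mk _ ⟨v, (S.glue b v h).hom.hom.hom z⟩))),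
        HEq ((q ≫ S.brArrowOver b v h ⟨Quot.mk _ ⟨_, y⟩, hE⟩ y rfl) ≫ eqToHom H ≫
          inv (S.brArrowOver b v h ⟨Quot.mk _ ⟨_, z⟩, hE'⟩ z rfl)) q := by
      intro z hz hE' H
      subst hz
      apply heq_of_eq
      rw [eqToHom_refl, Category.id_comp, Category.assoc]
      exact (congrArg (q ≫ ·) (IsIso.hom_inv_id _)).trans (Category.comp_id q)
    exact aux _ hgy _ _

/-- `glueOverFun ∘ glueOverInv = id`. [cite: MochizukiSemiAnbd2006, Prop 3.6 p.38] -/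
theorem CovObj.glueOverFun_glueOverInv (b : 𝒢.graph.Branch) (v : 𝒢.graph.Vertex)
    (h : 𝒢.graph.abuts b = some v) (s : S.FibV c v) :
    S.glueOverFun c b v h (S.glueOverInv c b v h s) = s := by
  cases s with | mk V' xp =>
  cases xp with | mk xx p =>
  cases xx with | mk x hx =>
  cases V' with | mk V hVb =>
  change Quot.mk _ _ = V at hx
  subst hx
  have hgx : (S.glue b v h).hom.hom.hom ((S.glue b v h).inv.hom.hom x) = x := S.glue_hom_inv b v h x
  refine CovObj.FibV.ext S c (Subtype.ext ?_) ?_ ?_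
  · change Quot.mk _ (⟨v, (S.glue b v h).hom.hom.hom ((S.glue b v h).inv.hom.hom x)⟩ :
      Σ v, (S.SV v).obj.V) = Quot.mk _ ⟨v, x⟩
    rw [hgx]
  · exact hgx
  · -- the path: `((p ≫ eqToHom H ≫ b̃⁻¹) ≫ b̃) = p ≫ eqToHom H ≍ p`
    change HEq ((p ≫ eqToHom _ ≫ inv (S.brArrowOver b v h
        ⟨Quot.mk _ ⟨_, (S.glue b v h).inv.hom.hom x⟩, rfl⟩ ((S.glue b v h).inv.hom.hom x) rfl)) ≫
      S.brArrowOver b v h ⟨Quot.mk _ ⟨_, (S.glue b v h).inv.hom.hom x⟩, rfl⟩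
        ((S.glue b v h).inv.hom.hom x) rfl) p
    rw [Category.assoc, Category.assoc, IsIso.inv_hom_id, Category.comp_id]
    exact comp_eqToHom_heq _ _

/-- The underlying bijection of the gluing of `𝒢_{∞,S}` along `b`. [cite: MochizukiSemiAnbd2006, Prop 3.6 p.38] -/
noncomputable def CovObj.glueOverEquiv (b : 𝒢.graph.Branch) (v : 𝒢.graph.Vertex)
    (h : 𝒢.graph.abuts b = some v) : S.FibE c (𝒢.graph.edgeOf b) ≃ S.FibV c v where
  toFun := S.glueOverFun c b v h
  invFun := S.glueOverInv c b v h
  left_inv := S.glueOverInv_glueOverFun c b v h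
  right_inv := S.glueOverFun_glueOverInv c b v h

/-- The gluing is `b_*`-equivariant: `glue (g · t) = b_*(g) · glue (t)`.
[cite: MochizukiSemiAnbd2006, Prop 3.6 p.38] -/
theorem CovObj.glueOverFun_act (b : 𝒢.graph.Branch) (v : 𝒢.graph.Vertex)
    (h : 𝒢.graph.abuts b = some v) (g : 𝒢.Ge (𝒢.graph.edgeOf b)) (t : S.FibE c (𝒢.graph.edgeOf b)) :
    S.glueOverFun c b v h (S.fibEAct c (𝒢.graph.edgeOf b) g t) =
      S.fibVAct c v (𝒢.brHom b v h g) (S.glueOverFun c b v h t) := by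
  cases t with | mk E' yq =>
  cases yq with | mk yy q =>
  cases yy with | mk y hy =>
  cases E' with | mk E hE =>
  change Quot.mk _ _ = E at hy
  subst hy
  have hρ := S.glue_ρ b v h g y
  have hV : (Quot.mk _ ⟨v, (S.glue b v h).hom.hom.hom ((S.SE (𝒢.graph.edgeOf b)).obj.ρ g y)⟩ :
      S.OVertex) = Quot.mk _ ⟨v, (S.glue b v h).hom.hom.hom y⟩ := by
    rw [hρ]
    exact (Quot.sound (CovObj.VRel.mk (S := S) v (𝒢.brHom b v h g) _)).symm
  refine CovObj.FibV.ext S c (Subtype.ext hV) hρ ?_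
  -- the paths: the same arrow of `Cat(𝔾_S)` up to the propositional equality of targets
  have aux : ∀ (V₁ V₂ : S.OVertex) (e : V₁ = V₂)
      (h₁ : S.orbitGraph.abuts ⟨(b, Quot.mk _ ⟨𝒢.graph.edgeOf b, y⟩), hE⟩ = some V₁)
      (h₂ : S.orbitGraph.abuts ⟨(b, Quot.mk _ ⟨𝒢.graph.edgeOf b, y⟩), hE⟩ = some V₂),
      HEq (q ≫ S.orbitGraph.brArrow ⟨(b, Quot.mk _ ⟨𝒢.graph.edgeOf b, y⟩), hE⟩ _ V₁ rfl h₁)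
        (q ≫ S.orbitGraph.brArrow ⟨(b, Quot.mk _ ⟨𝒢.graph.edgeOf b, y⟩), hE⟩ _ V₂ rfl h₂) := by
    intro V₁ V₂ e h₁ h₂
    subst e
    rfl
  exact aux _ _ hV _ _

/-- **The covering `𝒢_{∞,S} → 𝒢`** (p. 38: the covering of `𝒢_S` determined by the universal
graph-covering of `𝔾_S`, composed with `𝒢_S → 𝒢`), as an object of `B^cov(𝒢)`, for countable `𝒢`,
an object `S` and a base component `c` of `𝔾_S`. [cite: MochizukiSemiAnbd2006, Prop 3.6 p.38] -/
noncomputable def CovObj.univCoverOver (h𝒢 : 𝒢.IsCountable) : CovObj 𝒢 where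
  SV v := S.fibV c h𝒢 v
  SE e := S.fibE c h𝒢 e
  glue b v h := (temperedAction (𝒢.Ge (𝒢.graph.edgeOf b))).isoMk
    (Action.mkIso (Equiv.toIso (S.glueOverEquiv c b v h)) fun g => by
      apply ConcreteCategory.hom_ext
      intro t
      exact S.glueOverFun_act c b v h g t)

/-- The projection `𝒢_{∞,S} → 𝒢_S`, i.e. the morphism `univCoverOver S ⟶ S` of `B^cov(𝒢)`:
`(V, x, p) ↦ x`. [cite: MochizukiSemiAnbd2006, Prop 3.6 p.38] -/
noncomputable def CovObj.univCoverOverProj (h𝒢 : 𝒢.IsCountable) : S.univCoverOver c h𝒢 ⟶ S where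
  fV v := ObjectProperty.homMk
    { hom := TypeCat.ofHom fun t : S.FibV c v => t.2.1.1
      comm := fun _ => rfl }
  fE e := ObjectProperty.homMk
    { hom := TypeCat.ofHom fun t : S.FibE c e => t.2.1.1
      comm := fun _ => rfl }
  comm b v h := by
    apply ObjectProperty.hom_ext
    apply Action.Hom.ext
    apply ConcreteCategory.hom_ext
    intro t
    rfl

end ProfiniteSemiGraph

end Literature.AnabelianGeometry.SemiGraphs
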